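import Summits.ABC.IUTFork.Cor312GluedMonoidsReading3
import Summits.ABC.IUTFork.Thm311Checks
import Summits.ABC.IUTFork.Cor312StatementBridgeChecks
import HarnessLib

/-!
# Companion of `Cor312GluedMonoidsReading3`: the hypothesis bundle is JOINTLY SATISFIABLE (toy level)

Record/witness file (D-0012; abc-iut cell, wave 5, seat abc-iut-w5-d230). TAKES NO SIDE on [IUTchIII] Cor. 3.12. It shows that
the hypotheses of `Cor312Vol.GluedMonoids.statement_of_thm311_of_gluedMonoids` — Theorem 3.11 AS TYPED (`FullSituation.Statement`),
abc-iut-c312-6's `BridgeHyps`, the equivariance (hρ) of the region-forming operator, the Θ-glue (b1) and the q-glue (b2) — hold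
SIMULTANEOUSLY in a toy (abc-iut-c312-7's `Cor312.Checks.toySituation 0` with a Kummer-exact column, abc-iut-c312-1's one-object
link data `Thm311.toyLink`, abc-iut-c312-6's nonempty toy setting `Cor312Vol.Checks.toySettingNE`, `ρ :=` the constant operator
`Set.univ`), so the conditional kernel lemma is not a statement about the empty set of instances — the cell's vacuity-audit
duty (LANA Rem. 8.2.1). Two toy DATA definitions (`glueColumn`, `glueFull`), no `Prop` fact. Nothing about the intended
situation. [claim: Mochizuki2012, status: disputed]
-/

noncomputable section

open Set

namespace Summit.ABC.IUTFork.Cor312Vol.GluedMonoids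

open Thm311 Cor312 Literature.IUT.LogThetaLattice

/-! ## The hypothesis bundle is JOINTLY SATISFIABLE with Theorem 3.11 as typed (no vacuous conditional) -/

section Witness

/-- A Kummer-exact column over abc-iut-c312-7's toy shells: every Frobenius-like datum IS the coric datum `toyData 0`, the
unit/ball images are empty. DATA of a toy, no claim. [folklore] -/
def glueColumn : Column Cor312.Checks.toyShells where
  frobAdm := fun _ => (Cor312.Checks.toyData 0).Adm
  frobLogvol := fun _ => (Cor312.Checks.toyData 0).logvol
  frobΨ := fun _ => (Cor312.Checks.toyData 0).Ψ
  frobMmod := fun _ => (Cor312.Checks.toyData 0).Mmod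
  unitImage := fun _ _ _ _ => ∅
  ballImage := fun _ _ _ => ∅
  ObjLGP := Unit
  frobObjLGP := fun _ => Unit
  kumLGP := fun _ => Equiv.refl Unit
  ObjLgp := Unit
  frobObjLgp := fun _ => Unit
  kumLgp := fun _ => Equiv.refl Unit
  thetaPilot := fun _ => ()

/-- The toy full situation: c312-7's `toySituation 0` on every vertical line, the Kummer-exact column `glueColumn` everywhere, and
abc-iut-c312-1's one-object link data `Thm311.Checks.toyLink`. DATA of a toy. [folklore] -/
def glueFull : FullSituation Cor312.Checks.toyIndex where
  toSituation := Cor312.Checks.toySituation 0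
  col := fun _ => glueColumn
  link := Thm311.toyLink

/-- Theorem 3.11 (i) holds in `glueFull` (empty splitting monoid; one object of degree `0` whose region is everything, of
log-volume `0`; constant data on every line). [folklore] -/
theorem glueFull_partI : glueFull.PartI := by
  refine ⟨fun n v hv x hx => absurd hx (Set.notMem_empty x), fun n j J => ⟨fun _ => trivial, Set.toFinite _, ?_⟩,
    fun n n' => rfl⟩
  show (0 : ℝ) = ∑ᶠ vQ : Cor312.Checks.toyIndex.VQ, (Cor312.Checks.toyData 0).logvol j.1 vQ Set.univ
  simp_rw [Cor312.Checks.toyData_logvol_univ]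
  exact finsum_zero.symm

/-- Theorem 3.11 (ii) holds in `glueFull` (the column is Kummer-exact; (Ind3) is about empty images). [folklore] -/
theorem glueFull_partII : glueFull.toLatticeSituation.PartII := fun _ =>
  (glueColumn.partII_iff (Cor312.Checks.toyData 0)).2
    ⟨fun _ _ _ _ h => ⟨h, rfl⟩, fun _ _ _ => rfl, fun _ _ => rfl,
      ⟨fun _ _ _ _ _ => Set.empty_subset _, fun _ _ _ _ =>
        ⟨Set.empty_subset _, Set.empty_subset _, fun _ _ => Set.empty_subset _⟩⟩⟩

/-- Theorem 3.11 (iii) holds in `glueFull` (abc-iut-c312-1's toy link: full poly-isomorphisms, identity automorphisms). [folklore] -/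
theorem glueFull_partIII : glueFull.PartIII := by
  refine ⟨Thm311.toyLink.partIIIa_holds, Thm311.toyLink.partIIIb_holds, ?_, ?_,
    glueFull.evalCompatUpToInd_of_multiradialCompat glueFull_partI.2.2⟩
  · refine Thm311.toyLink.partIIIc_of_full (fun _ => rfl) fun n m => ?_
    rintro p ⟨a, rfl⟩; rfl
  · intro n m; exact PolyIsoCalc.stabilized_full _ _

/-- Theorem 3.11 as typed holds in `glueFull`. [folklore] -/
theorem glueFull_statement : glueFull.Statement := ⟨glueFull_partI, glueFull_partII, glueFull_partIII⟩

/-- The constant region-forming operator `Set.univ` is equivariant under every packet automorphism. [folklore] -/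
theorem const_univ_equivariant (Φ : Cor312.Checks.toyShells.PacketAut) (Ψ : ∀ v : Cor312.Checks.toyIndex.V, v ∈ Cor312.Checks.toyIndex.Vbad → Set (Cor312.Checks.toyShells.StarPacket v))
    (j : Cor312.Checks.toyIndex.Label) (vQ : Cor312.Checks.toyIndex.VQ) :
    (fun (_ : ∀ v : Cor312.Checks.toyIndex.V, v ∈ Cor312.Checks.toyIndex.Vbad → Set (Cor312.Checks.toyShells.StarPacket v)) (j : Cor312.Checks.toyIndex.Label) (vQ : Cor312.Checks.toyIndex.VQ) =>
        (Set.univ : Set (Cor312.Checks.toyShells.Packet j vQ))) (fun v hv => Cor312.Checks.toyShells.starAut Φ v '' Ψ v hv) j vQ =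
      Φ j vQ '' (fun (_ : ∀ v : Cor312.Checks.toyIndex.V, v ∈ Cor312.Checks.toyIndex.Vbad → Set (Cor312.Checks.toyShells.StarPacket v)) (j : Cor312.Checks.toyIndex.Label)
        (vQ : Cor312.Checks.toyIndex.VQ) => (Set.univ : Set (Cor312.Checks.toyShells.Packet j vQ))) Ψ j vQ :=
  (Set.image_univ_of_surjective (Φ j vQ).surjective).symm

/-- **JOINT SATISFIABILITY.** There is a full situation satisfying Theorem 3.11 AS TYPED, with a Cor.-3.12 setting satisfying
abc-iut-c312-6's `BridgeHyps`, a region-forming operator and a line `n'` for which (hρ), (b1) and (b2) ALL hold (abc-iut-c312-6's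
nonempty toy `Cor312Vol.Checks.toySettingNE` over `glueFull`, `ρ :=` the constant operator `Set.univ`): the conditional `statement_of_thm311_of_gluedMonoids` is not a
statement about the empty set of instances. Toy level; nothing about the intended situation. [folklore] -/
theorem gluedMonoids_hypotheses_satisfiable :
    ∃ (T : ThetaIndex) (S : FullSituation T) (P : Cor312.Setting S.toLatticeSituation.toSituation)
      (ρ : (∀ v : T.V, v ∈ T.Vbad → Set (S.L.StarPacket v)) → ∀ (j : T.Label) (vQ : T.VQ), Set (S.L.Packet j vQ)) (n' : ℤ),
      S.Statement ∧ BridgeHyps P ∧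
      (∀ Φ ∈ Subgroup.closure (S.L.Ind1Family ∪ S.L.Ind2Family),
        ∀ (Ψ : ∀ v : T.V, v ∈ T.Vbad → Set (S.L.StarPacket v)) (j : T.Label) (vQ : T.VQ),
          ρ (fun v hv => S.L.starAut Φ v '' Ψ v hv) j vQ = Φ j vQ '' ρ Ψ j vQ) ∧
      (∀ (m : ℤ) (j : T.Label) (vQ : T.VQ), P.thetaRegion m j vQ = ρ ((S.col P.n).frobΨ m) j vQ) ∧
      (∀ (j : T.Label) (vQ : T.VQ), P.qRegion j vQ = ρ (S.D n').Ψ j vQ) :=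
  ⟨Cor312.Checks.toyIndex, glueFull, Cor312Vol.Checks.toySettingNE, fun _ _ _ => Set.univ, 0, glueFull_statement,
    Cor312Vol.Checks.bridgeHyps_toySettingNE,
    fun Φ _ Ψ j vQ => const_univ_equivariant Φ Ψ j vQ, fun _ _ _ => rfl, fun _ _ => rfl⟩

/-- … and there the conclusion indeed holds (consistency check of the route end to end). [folklore] -/
theorem glueFull_toySettingNE_statement :
    (Cor312Vol.Checks.toySettingNE : Cor312.Setting glueFull.toLatticeSituation.toSituation).Statement :=
  statement_of_thm311_of_gluedMonoids glueFull Cor312Vol.Checks.toySettingNE (fun _ _ _ => Set.univ) glueFull_statement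
    Cor312Vol.Checks.bridgeHyps_toySettingNE
    (fun Φ _ Ψ j vQ => const_univ_equivariant Φ Ψ j vQ) (fun _ _ _ => rfl) 0 (fun _ _ => rfl)

end Witness

end Summit.ABC.IUTFork.Cor312Vol.GluedMonoids

end
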